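import Summits.HodgeConjecture.CorCM.Census.HalfParity

/-!
# The half-parity law, II: stabilisers, the construction of half-block sets, the parity relations, canonicity

COR-CM (cell `pub-hodgecm2`), count-neutral kernel combinatorics by the binder seat b09 (gen 30; lane HALF-PARITY-LAW,
André-3's ask A6-R52), part II, sequel of `Census/HalfParity.lean` (`hsum`, `sat`, the coboundary formula
`hsum A (x·Q⁻¹) = hsum A x + [Q ∉ H]·hsum (sat A) x`, `rad2 ≤ ker (hsum A)`).  Three bookkeeping definitions (`stab`, `horb`,
`halfOf`) + theorems; no `Prop`-valued definition, no `decide` beyond identities in `𝔽₂` with ≤ 3 variables, no certificate,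
no named fact, no `sorry`.  HONEST FRAMING: `HC_CM` is NOT proved; nothing here is a period or a headline.

CONTENT.
* §1 **Stabilisers** `stab Ψ = {Q | Ψ·Q⁻¹ = Ψ} ≤ G` (`↔` the reflex-type stabiliser; `[K_b : Stab_b·⟨c⟩]` in André-3's notation)
  and their conjugation under base change (`mem_stab_rt_iff`).  Index two ⇒ normal (`conj_mem_of_index_two`).
* §2 **ADMISSIBILITY ⟺ EXISTENCE.**  (⇒) If `A` is a half-block set of `H` (`H`-stable, disjoint from `A·Q⁻¹` for `Q ∉ H`,
  `H` of index two) then **every type of `sat A` has `stab ≤ H`** (`stab_le_of_half`).  (⇐) THE CONSTRUCTION: the `H`-orbit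
  `horb H Φ` of a type with `stab Φ ≤ H` is a half-block set with saturation the block of `Φ` (`horb_stable`, `horb_disjoint`,
  `mem_sat_horb_iff`), and for a set `R` of blocks all of whose types have stabiliser `≤ H` the union `halfOf H R` of the
  `H`-orbits of representatives is a half-block set with `sat = blk⁻¹ R` (`halfOf_stable`, `halfOf_disjoint`, `mem_sat_halfOf_iff`)
  — André-3's `ψ_{R,H}` is `hsum (halfOf H R)`, and part I applies: `rad2 ≤ ker hsum (halfOf H R)` whenever `R` is a relation
  (`rad2_le_ker_hsum_halfOf`).
* §3 **THE PARITY RELATIONS CLASSIFIED** (`sum_par_eq_zero_iff`): `Σ_{b ∈ R} par(face)_b = 0` for all faces **iff**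
  `R ∈ {∅, all blocks}` or (the weight parity is block-constant, `δ = 1`, AND `R` is one of the two weight-parity classes
  `{w̄ = 0}`, `{w̄ = 1}`) — gen 28's `annihilator_cases` read on indicator vectors; so the admissible `(R, H)` of the law are:
  `R` = all blocks (all stabilisers in `H`), or `δ = 1` and `R` a weight class (its stabilisers in `H`).
* §4 **CANONICITY.**  Two half-block sets of the same `H` with the same saturation have `hsum A₁ + hsum A₂` invariant on the
  AMBIENT module, hence a parity combination (`exists_hsum_add_hsum_eq_sum_par2`): the class of `ψ_{R,H}` modulo parities does
  not depend on the representatives.  **KLEIN RELATION** (`exists_hsum_three_eq_sum_par2`): for three index-two subgroups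
  with `Q ∈ H₃ ↔ (Q ∈ H₁ ↔ Q ∈ H₂)` and half-block sets of the same saturation, `ψ₁ + ψ₂ + ψ₃` is a parity combination
  (`χ₁ + χ₂ = χ₃`) — why `Q₈` (three index-two subgroups `∋ −1`) has `t = 2`, not `3`.

## References
* [Pohlmann1968] H. Pohlmann, Algebraic cycles on abelian varieties of complex multiplication type, Ann. of Math. 88 (1968), Thm 1.
* [Milne1999] J. S. Milne, Lefschetz motives and the Tate conjecture, Compositio Math. 117 (1999), Prop. 2.1, p. 54.
-/

namespace Summit.HodgeConjecture.CorCM.Census.HalfParity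

open Finset
open Summit.HodgeConjecture.CorCM.Prior.AllgGroup.RfwfAllgGroup
open Summit.HodgeConjecture.CorCM.Census.BlockParity
open Summit.HodgeConjecture.CorCM.Census.Coinvariant

noncomputable section

variable {G : Type*} [Group G] [Fintype G] [DecidableEq G] (c : G)

/-! ## §1 Stabilisers -/

/-- **The stabiliser** of a type under base change: `stab Ψ = {Q | Ψ·Q⁻¹ = Ψ}`. [folklore] -/
def stab (Ψ : CMF G c) : Subgroup G where
  carrier := {Q | rt c Q Ψ = Ψ}
  mul_mem' {Q Q'} hQ hQ' := by
    change rt c (Q * Q') Ψ = Ψ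
    rw [rt_mul, hQ', hQ]
  one_mem' := rt_one c Ψ
  inv_mem' {Q} hQ := by
    change rt c Q⁻¹ Ψ = Ψ
    conv_lhs => rw [← hQ]
    rw [rt_inv_rt]

/-- `Q ∈ stab Ψ ↔ Ψ·Q⁻¹ = Ψ`. [folklore] -/
@[simp] theorem mem_stab (Ψ : CMF G c) (Q : G) : Q ∈ stab c Ψ ↔ rt c Q Ψ = Ψ := Iff.rfl

/-- **Stabilisers along a block are conjugate**: `Q ∈ stab (Ψ·P⁻¹) ↔ P⁻¹ Q P ∈ stab Ψ`. [folklore] -/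
theorem mem_stab_rt_iff (Ψ : CMF G c) (P Q : G) : Q ∈ stab c (rt c P Ψ) ↔ P⁻¹ * Q * P ∈ stab c Ψ := by
  rw [mem_stab, mem_stab]
  constructor
  · intro h
    rw [rt_mul, rt_mul, h, rt_inv_rt]
  · intro h
    have h' := congrArg (rt c P) h
    rwa [← rt_mul, ← mul_assoc, ← mul_assoc, mul_inv_cancel, one_mul, rt_mul] at h'

omit [Fintype G] [DecidableEq G] in
/-- An index-two subgroup is normal: `P Q P⁻¹ ∈ H ↔ Q ∈ H`. [folklore] -/
theorem conj_mem_iff_of_index_two {H : Subgroup G} (hH : H.index = 2) (P Q : G) : P * Q * P⁻¹ ∈ H ↔ Q ∈ H := by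
  rw [Subgroup.mul_mem_iff_of_index_two hH, Subgroup.mul_mem_iff_of_index_two hH, H.inv_mem_iff]
  tauto

/-! ## §2 Admissibility ⟺ existence of a half-block set -/

/-- **(⇒) Necessity.**  If `A` is disjoint from its translates `A·Q⁻¹`, `Q ∉ H` (`H` of index two; `H`-stability is not even
needed), every type of its saturation has its stabiliser inside `H`. [folklore] -/
theorem stab_le_of_half {H : Subgroup G} (hH : H.index = 2) {A : Finset (CMF G c)}
    (hdj : ∀ Q ∉ H, ∀ Ψ ∈ A, rt c Q Ψ ∉ A) {Ψ : CMF G c} (hΨ : Ψ ∈ sat c A) : stab c Ψ ≤ H := by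
  intro Q hQ
  obtain ⟨P, hP⟩ := (mem_sat c A Ψ).mp hΨ
  -- `P Q P⁻¹` stabilises `Ψ·P⁻¹ ∈ A`, hence lies in `H`
  have hconj : P * Q * P⁻¹ ∈ stab c (rt c P Ψ) := by
    rw [mem_stab_rt_iff, ← mul_assoc, ← mul_assoc, inv_mul_cancel, one_mul, inv_mul_cancel_right]
    exact hQ
  have hmem : P * Q * P⁻¹ ∈ H := by
    by_contra h
    exact hdj _ h _ hP (by rw [(mem_stab c _ _).mp hconj]; exact hP)
  exact (conj_mem_iff_of_index_two hH P Q).mp hmem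

/-- **The `H`-orbit** of a type: `horb H Φ = {Φ·Q⁻¹ | Q ∈ H}`. [folklore] -/
def horb (H : Subgroup G) (Φ : CMF G c) : Finset (CMF G c) := by
  classical exact (univ.filter fun Q : G => Q ∈ H).image fun Q => rt c Q Φ

/-- `Ψ ∈ horb H Φ ↔ Ψ = Φ·Q⁻¹` for some `Q ∈ H`. [folklore] -/
theorem mem_horb (H : Subgroup G) (Φ Ψ : CMF G c) : Ψ ∈ horb c H Φ ↔ ∃ Q ∈ H, rt c Q Φ = Ψ := by
  classical
  simp only [horb, mem_image, mem_filter, mem_univ, true_and]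

/-- `Φ ∈ horb H Φ`. [folklore] -/
theorem self_mem_horb (H : Subgroup G) (Φ : CMF G c) : Φ ∈ horb c H Φ := (mem_horb c H Φ Φ).mpr ⟨1, H.one_mem, rt_one c Φ⟩

/-- **The `H`-orbit is `H`-stable.** [folklore] -/
theorem horb_stable (H : Subgroup G) (Φ : CMF G c) : ∀ Q ∈ H, ∀ Ψ ∈ horb c H Φ, rt c Q Ψ ∈ horb c H Φ := by
  intro Q hQ Ψ hΨ
  obtain ⟨Q', hQ', rfl⟩ := (mem_horb c H Φ Ψ).mp hΨ
  exact (mem_horb c H Φ _).mpr ⟨Q * Q', H.mul_mem hQ hQ', rt_mul c Q Q' Φ⟩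

/-- **The `H`-orbit is disjoint from its outside translates** when `stab Φ ≤ H`. [folklore] -/
theorem horb_disjoint (H : Subgroup G) {Φ : CMF G c} (hΦ : stab c Φ ≤ H) :
    ∀ Q ∉ H, ∀ Ψ ∈ horb c H Φ, rt c Q Ψ ∉ horb c H Φ := by
  intro Q hQ Ψ hΨ hQΨ
  obtain ⟨Q₁, hQ₁, rfl⟩ := (mem_horb c H Φ Ψ).mp hΨ
  obtain ⟨Q₂, hQ₂, he⟩ := (mem_horb c H Φ _).mp hQΨ
  -- `Q₂⁻¹ Q Q₁ ∈ stab Φ ≤ H`, so `Q ∈ H`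
  have hs : Q₂⁻¹ * (Q * Q₁) ∈ stab c Φ := by
    rw [mem_stab, rt_mul, rt_mul, ← he, rt_inv_rt]
  have h2 := hΦ hs
  rw [H.mul_mem_cancel_left (H.inv_mem hQ₂), H.mul_mem_cancel_right hQ₁] at h2
  exact hQ h2

/-- The saturation of the `H`-orbit is the whole block of `Φ`. [folklore] -/
theorem mem_sat_horb_iff (H : Subgroup G) (Φ Ψ : CMF G c) : Ψ ∈ sat c (horb c H Φ) ↔ blk c Ψ = blk c Φ := by
  rw [mem_sat]
  constructor
  · rintro ⟨Q, hQ⟩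
    obtain ⟨Q', -, he⟩ := (mem_horb c H Φ _).mp hQ
    rw [← blk_rt c Q Ψ, ← he, blk_rt]
  · intro h
    obtain ⟨Q, hQ⟩ := exists_rt_eq_of_blk_eq c h
    exact ⟨Q, hQ ▸ self_mem_horb c H Φ⟩

/-- **The half-block set of `(R, H)`**: the union of the `H`-orbits of representatives of the blocks in `R`
(André-3's labels «with embedding coset in `H`»). [folklore] -/
def halfOf (H : Subgroup G) (R : Finset (Block c)) : Finset (CMF G c) := R.biUnion fun b => horb c H (Quotient.out b)

/-- Membership in `halfOf H R`. [folklore] -/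
theorem mem_halfOf (H : Subgroup G) (R : Finset (Block c)) (Ψ : CMF G c) :
    Ψ ∈ halfOf c H R ↔ ∃ b ∈ R, Ψ ∈ horb c H (Quotient.out b) := by
  rw [halfOf, mem_biUnion]

/-- The block of a member of `horb H out(b)` is `b`. [folklore] -/
theorem blk_eq_of_mem_horb_out (H : Subgroup G) {b : Block c} {Ψ : CMF G c} (h : Ψ ∈ horb c H (Quotient.out b)) :
    blk c Ψ = b := by
  obtain ⟨Q, -, rfl⟩ := (mem_horb c H _ Ψ).mp h
  rw [blk_rt]
  exact Quotient.out_eq b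

/-- `halfOf H R` lies over the blocks of `R`. [folklore] -/
theorem blk_mem_of_mem_halfOf (H : Subgroup G) {R : Finset (Block c)} {Ψ : CMF G c} (h : Ψ ∈ halfOf c H R) : blk c Ψ ∈ R := by
  obtain ⟨b, hb, hΨ⟩ := (mem_halfOf c H R Ψ).mp h
  rwa [blk_eq_of_mem_horb_out c H hΨ]

/-- **`halfOf H R` is `H`-stable.** [folklore] -/
theorem halfOf_stable (H : Subgroup G) (R : Finset (Block c)) : ∀ Q ∈ H, ∀ Ψ ∈ halfOf c H R, rt c Q Ψ ∈ halfOf c H R := by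
  intro Q hQ Ψ hΨ
  obtain ⟨b, hb, hΨb⟩ := (mem_halfOf c H R Ψ).mp hΨ
  exact (mem_halfOf c H R _).mpr ⟨b, hb, horb_stable c H _ Q hQ Ψ hΨb⟩

/-- **`halfOf H R` is disjoint from its outside translates** when every type over `R` has stabiliser `≤ H`. [folklore] -/
theorem halfOf_disjoint (H : Subgroup G) {R : Finset (Block c)} (hR : ∀ Ψ : CMF G c, blk c Ψ ∈ R → stab c Ψ ≤ H) :
    ∀ Q ∉ H, ∀ Ψ ∈ halfOf c H R, rt c Q Ψ ∉ halfOf c H R := by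
  intro Q hQ Ψ hΨ hQΨ
  obtain ⟨b, hb, hΨb⟩ := (mem_halfOf c H R Ψ).mp hΨ
  obtain ⟨b', -, hQΨb'⟩ := (mem_halfOf c H R _).mp hQΨ
  have hbb' : b' = b := by
    rw [← blk_eq_of_mem_horb_out c H hQΨb', blk_rt, blk_eq_of_mem_horb_out c H hΨb]
  subst hbb'
  have hst : stab c (Quotient.out b') ≤ H := hR _ (by rw [show blk c (Quotient.out b') = b' from Quotient.out_eq b'] ; exact hb)
  exact horb_disjoint c H hst Q hQ Ψ hΨb hQΨb'

/-- **The saturation of `halfOf H R` is `blk⁻¹ R`.** [folklore] -/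
theorem mem_sat_halfOf_iff (H : Subgroup G) (R : Finset (Block c)) (Ψ : CMF G c) : Ψ ∈ sat c (halfOf c H R) ↔ blk c Ψ ∈ R := by
  rw [mem_sat]
  constructor
  · rintro ⟨Q, hQ⟩
    rw [← blk_rt c Q Ψ]
    exact blk_mem_of_mem_halfOf c H hQ
  · intro h
    have hb : blk c Ψ = blk c (Quotient.out (blk c Ψ)) := (Quotient.out_eq _).symm
    obtain ⟨Q, hQ⟩ := ((mem_sat_horb_iff c H (Quotient.out (blk c Ψ)) Ψ).mpr hb)
      |> (mem_sat c _ Ψ).mp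
    exact ⟨Q, (mem_halfOf c H R _).mpr ⟨blk c Ψ, h, hQ⟩⟩

/-- The blocks of `sat (halfOf H R)` are exactly `R`. [folklore] -/
theorem image_blk_sat_halfOf (H : Subgroup G) (R : Finset (Block c)) : (sat c (halfOf c H R)).image (blk c) = R := by
  ext b
  rw [mem_image]
  constructor
  · rintro ⟨Ψ, hΨ, rfl⟩
    exact (mem_sat_halfOf_iff c H R Ψ).mp hΨ
  · intro hb
    obtain ⟨Ψ, rfl⟩ := blk_surjective c b
    exact ⟨Ψ, (mem_sat_halfOf_iff c H R Ψ).mpr hb, rfl⟩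

/-- **`hsum (sat (halfOf H R)) = Σ_{b ∈ R} par2_b`** — the indicator relation `1_R`. [folklore] -/
theorem hsum_sat_halfOf (H : Subgroup G) (R : Finset (Block c)) (x : CMF G c →₀ ZMod 2) :
    hsum c (sat c (halfOf c H R)) x = ∑ b ∈ R, par2 c x b := by
  rw [hsum_sat_eq_sum_par2, image_blk_sat_halfOf]

/-- **André-3's `ψ_{R,H}` is a functional on the coinvariant fibre**: for `H` of index two containing `c`, `R` a set of blocks
whose types have stabilisers `≤ H` and which is a PARITY RELATION on the faces, `rad2 ≤ ker hsum (halfOf H R)`. [folklore] -/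
theorem rad2_le_ker_hsum_halfOf {hc2 : c * c = 1} {H : Subgroup G} (hH : H.index = 2) (hcH : c ∈ H) {R : Finset (Block c)}
    (hR : ∀ Ψ : CMF G c, blk c Ψ ∈ R → stab c Ψ ≤ H)
    (hrel : ∀ (Φ : CMF G c) (t t' : G), t' ∉ orb c t → ∑ b ∈ R, par c (gface c hc2 Φ t t') b = 0) :
    rad2 c hc2 ≤ LinearMap.ker (hsum c (halfOf c H R)) := by
  refine rad2_le_ker_hsum c hH hcH (halfOf_stable c H R) (halfOf_disjoint c H hR)
    (face2_le_ker_hsum_of_sum_par_eq_zero c (sat_stable c _) fun Φ t t' ht' => ?_)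
  rw [image_blk_sat_halfOf]
  exact hrel Φ t t' ht'

/-- … and the coboundary of `ψ_{R,H}` on the ambient module is `χ_H ∪ 1_R`:
`hsum (halfOf H R) (x·Q⁻¹) = hsum (halfOf H R) x + Σ_{b ∈ R} par2(x)_b` for `Q ∉ H`. [folklore] -/
theorem hsum_halfOf_mapDomain_rt_of_notMem {H : Subgroup G} (hH : H.index = 2) {R : Finset (Block c)}
    (hR : ∀ Ψ : CMF G c, blk c Ψ ∈ R → stab c Ψ ≤ H) {Q : G} (hQ : Q ∉ H) (x : CMF G c →₀ ZMod 2) :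
    hsum c (halfOf c H R) (Finsupp.mapDomain (rt c Q) x) = hsum c (halfOf c H R) x + ∑ b ∈ R, par2 c x b := by
  rw [hsum_mapDomain_rt_of_notMem c hH (halfOf_stable c H R) (halfOf_disjoint c H hR) hQ, hsum_sat_halfOf]

/-! ## §3 The parity relations classified -/

/-- `Σ_{b ∈ R} par(y)_b = Σ_b 1_R(b) · par(y)_b`. [folklore] -/
theorem sum_par_eq_sum_indicator_mul (R : Finset (Block c)) (y : CMF G c →₀ ℤ) :
    ∑ b ∈ R, par c y b = ∑ b, (if b ∈ R then (1 : ZMod 2) else 0) * par c y b := by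
  simp_rw [ite_mul, one_mul, zero_mul]
  rw [Finset.sum_ite_mem, Finset.univ_inter]

/-- **THE PARITY RELATIONS CLASSIFIED.**  `Σ_{b ∈ R} par(face)_b = 0` for every face iff `R = ∅`, or `R` = all blocks, or the
weight parity is block-constant and `R` is one of its two classes. [folklore] -/
theorem sum_par_eq_zero_iff (hc2 : c * c = 1) (T₀ : CMF G c) (R : Finset (Block c)) :
    (∀ (Φ : CMF G c) (t t' : G), t' ∉ orb c t → ∑ b ∈ R, par c (gface c hc2 Φ t t') b = 0) ↔
      R = ∅ ∨ R = univ ∨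
        ((∀ (Q : G) (Ψ : CMF G c), wpar c T₀ (rt c Q Ψ) = wpar c T₀ Ψ) ∧
          (R = univ.filter (fun b => wbar c T₀ b = 0) ∨ R = univ.filter (fun b => wbar c T₀ b = 1))) := by
  constructor
  · intro hR
    have ha : ∀ (Φ : CMF G c) (t t' : G), t' ∉ orb c t →
        ∑ b, (if b ∈ R then (1 : ZMod 2) else 0) * par c (gface c hc2 Φ t t') b = 0 := fun Φ t t' ht' => by
      rw [← sum_par_eq_sum_indicator_mul]; exact hR Φ t t' ht'
    rcases annihilator_cases hc2 ha T₀ with hconst | ⟨hW, haff⟩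
    · by_cases h0 : blk c T₀ ∈ R
      · right; left
        exact eq_univ_of_forall fun b => by
          have := hconst b; rw [if_pos h0] at this; by_contra hb; rw [if_neg hb] at this; exact zero_ne_one this
      · left
        exact Finset.eq_empty_of_forall_notMem fun b hb => by
          have := hconst b; rw [if_pos hb, if_neg h0] at this; exact one_ne_zero this
    · right; right
      refine ⟨hW, ?_⟩
      have key : ∀ b, (b ∈ R ↔ (if blk c T₀ ∈ R then (1 : ZMod 2) else 0) + wbar c T₀ b = 1) := fun b => by
        obtain ⟨Ψ, rfl⟩ := blk_surjective c b
        have e := haff Ψ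
        rw [wbar_blk c T₀ hW]
        constructor
        · intro hb; rw [if_pos hb] at e; exact e.symm
        · intro hb; by_contra h; rw [if_neg h] at e; exact zero_ne_one (e.trans hb)
      have h01 : ∀ w : ZMod 2, w = 0 ∨ w = 1 := by decide
      by_cases h0 : blk c T₀ ∈ R
      · left
        ext b
        rw [key b, if_pos h0, mem_filter]
        rcases h01 (wbar c T₀ b) with h | h <;> simp [h]
      · right
        ext b
        rw [key b, if_neg h0, zero_add, mem_filter]
        simp
  · rintro (rfl | rfl | ⟨hW, rfl | rfl⟩) Φ t t' ht'
    · exact Finset.sum_empty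
    · exact sum_par_gface c hc2 Φ t t'
    · -- `{w̄ = 0}` = all blocks minus `{w̄ = 1}`
      have h1 : ∑ b ∈ univ.filter (fun b => wbar c T₀ b = 1), par c (gface c hc2 Φ t t') b = 0 := by
        rw [Finset.sum_filter]
        have e : ∀ b, (if wbar c T₀ b = 1 then par c (gface c hc2 Φ t t') b else 0) =
            wbar c T₀ b * par c (gface c hc2 Φ t t') b := fun b => by
          have h01 : wbar c T₀ b = 0 ∨ wbar c T₀ b = 1 := by
            have : ∀ w : ZMod 2, w = 0 ∨ w = 1 := by decide
            exact this _
          rcases h01 with h | h <;> simp [h]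
        simp_rw [e]
        rw [sum_wbar_mul_par c T₀ hW, wlin_gface]
      have hsplit := Finset.sum_filter_add_sum_filter_not univ (fun b => wbar c T₀ b = 1) (fun b => par c (gface c hc2 Φ t t') b)
      rw [h1, zero_add, sum_par_gface c hc2 Φ t t'] at hsplit
      have e : univ.filter (fun b => wbar c T₀ b = 0) = univ.filter (fun b => ¬ wbar c T₀ b = 1) := by
        refine Finset.filter_congr fun b _ => ?_
        have : ∀ w : ZMod 2, w = 0 ↔ ¬ w = 1 := by decide
        exact this _
      rw [e]
      exact hsplit
    · rw [Finset.sum_filter]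
      have e : ∀ b, (if wbar c T₀ b = 1 then par c (gface c hc2 Φ t t') b else 0) =
          wbar c T₀ b * par c (gface c hc2 Φ t t') b := fun b => by
        have h01 : wbar c T₀ b = 0 ∨ wbar c T₀ b = 1 := by
          have : ∀ w : ZMod 2, w = 0 ∨ w = 1 := by decide
          exact this _
        rcases h01 with h | h <;> simp [h]
      simp_rw [e]
      rw [sum_wbar_mul_par c T₀ hW, wlin_gface]

/-! ## §4 Canonicity modulo parities and the Klein relation -/

/-- **Canonicity.**  Two half-block sets of the same index-two `H` with the same saturation differ by an invariant AMBIENT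
functional, i.e. by a block-parity combination: the class of `ψ_{R,H}` modulo parities is choice-free. [folklore] -/
theorem exists_hsum_add_hsum_eq_sum_par2 {H : Subgroup G} (hH : H.index = 2) {A₁ A₂ : Finset (CMF G c)}
    (hst₁ : ∀ Q ∈ H, ∀ Ψ ∈ A₁, rt c Q Ψ ∈ A₁) (hdj₁ : ∀ Q ∉ H, ∀ Ψ ∈ A₁, rt c Q Ψ ∉ A₁)
    (hst₂ : ∀ Q ∈ H, ∀ Ψ ∈ A₂, rt c Q Ψ ∈ A₂) (hdj₂ : ∀ Q ∉ H, ∀ Ψ ∈ A₂, rt c Q Ψ ∉ A₂) (hsat : sat c A₁ = sat c A₂) :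
    ∃ a : Block c → ZMod 2, ∀ x, hsum c A₁ x + hsum c A₂ x = ∑ b, a b * par2 c x b := by
  refine exists_eq_sum_par2_of_invariant c (hsum c A₁ + hsum c A₂) fun Q x => ?_
  rw [LinearMap.add_apply, LinearMap.add_apply]
  by_cases hQ : Q ∈ H
  · rw [hsum_mapDomain_rt_of_mem c hst₁ hQ, hsum_mapDomain_rt_of_mem c hst₂ hQ]
  · rw [hsum_mapDomain_rt_of_notMem c hH hst₁ hdj₁ hQ, hsum_mapDomain_rt_of_notMem c hH hst₂ hdj₂ hQ, hsat]
    have key : ∀ u v s : ZMod 2, u + s + (v + s) = u + v := by decide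
    exact key _ _ _

/-- **The Klein relation.**  For three index-two subgroups with `Q ∈ H₃ ↔ (Q ∈ H₁ ↔ Q ∈ H₂)` (the three over `H₁ ∩ H₂`) and
half-block sets `Aᵢ` of `Hᵢ` with a common saturation, `ψ₁ + ψ₂ + ψ₃` is a block-parity combination (`χ₁ + χ₂ + χ₃ = 0`).
[folklore] -/
theorem exists_hsum_three_eq_sum_par2 {H₁ H₂ H₃ : Subgroup G} (h₁ : H₁.index = 2) (h₂ : H₂.index = 2) (h₃ : H₃.index = 2)
    (hK : ∀ Q : G, Q ∈ H₃ ↔ (Q ∈ H₁ ↔ Q ∈ H₂)) {A₁ A₂ A₃ : Finset (CMF G c)}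
    (hst₁ : ∀ Q ∈ H₁, ∀ Ψ ∈ A₁, rt c Q Ψ ∈ A₁) (hdj₁ : ∀ Q ∉ H₁, ∀ Ψ ∈ A₁, rt c Q Ψ ∉ A₁)
    (hst₂ : ∀ Q ∈ H₂, ∀ Ψ ∈ A₂, rt c Q Ψ ∈ A₂) (hdj₂ : ∀ Q ∉ H₂, ∀ Ψ ∈ A₂, rt c Q Ψ ∉ A₂)
    (hst₃ : ∀ Q ∈ H₃, ∀ Ψ ∈ A₃, rt c Q Ψ ∈ A₃) (hdj₃ : ∀ Q ∉ H₃, ∀ Ψ ∈ A₃, rt c Q Ψ ∉ A₃)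
    (h12 : sat c A₁ = sat c A₂) (h13 : sat c A₁ = sat c A₃) :
    ∃ a : Block c → ZMod 2, ∀ x, hsum c A₁ x + hsum c A₂ x + hsum c A₃ x = ∑ b, a b * par2 c x b := by
  refine exists_eq_sum_par2_of_invariant c (hsum c A₁ + hsum c A₂ + hsum c A₃) fun Q x => ?_
  simp only [LinearMap.add_apply]
  have k1 : ∀ u v w s : ZMod 2, u + (v + s) + (w + s) = u + v + w := by decide
  have k2 : ∀ u v w s : ZMod 2, u + s + v + (w + s) = u + v + w := by decide
  have k3 : ∀ u v w s : ZMod 2, u + s + (v + s) + w = u + v + w := by decide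
  by_cases hQ₁ : Q ∈ H₁ <;> by_cases hQ₂ : Q ∈ H₂
  · have hQ₃ : Q ∈ H₃ := (hK Q).mpr (iff_of_true hQ₁ hQ₂)
    rw [hsum_mapDomain_rt_of_mem c hst₁ hQ₁, hsum_mapDomain_rt_of_mem c hst₂ hQ₂, hsum_mapDomain_rt_of_mem c hst₃ hQ₃]
  · have hQ₃ : Q ∉ H₃ := fun h => hQ₂ (((hK Q).mp h).mp hQ₁)
    rw [hsum_mapDomain_rt_of_mem c hst₁ hQ₁, hsum_mapDomain_rt_of_notMem c h₂ hst₂ hdj₂ hQ₂,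
      hsum_mapDomain_rt_of_notMem c h₃ hst₃ hdj₃ hQ₃, ← h12, ← h13]
    exact k1 _ _ _ _
  · have hQ₃ : Q ∉ H₃ := fun h => hQ₁ (((hK Q).mp h).mpr hQ₂)
    rw [hsum_mapDomain_rt_of_notMem c h₁ hst₁ hdj₁ hQ₁, hsum_mapDomain_rt_of_mem c hst₂ hQ₂,
      hsum_mapDomain_rt_of_notMem c h₃ hst₃ hdj₃ hQ₃, ← h13]
    exact k2 _ _ _ _
  · have hQ₃ : Q ∈ H₃ := (hK Q).mpr (iff_of_false hQ₁ hQ₂)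
    rw [hsum_mapDomain_rt_of_notMem c h₁ hst₁ hdj₁ hQ₁, hsum_mapDomain_rt_of_notMem c h₂ hst₂ hdj₂ hQ₂,
      hsum_mapDomain_rt_of_mem c hst₃ hQ₃, ← h12]
    exact k3 _ _ _ _

end

end Summit.HodgeConjecture.CorCM.Census.HalfParity
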